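import Mathlib
import Literature.Barriers.ValiantsHypothesis.AlgebraicNaturalProofs
import Summits.ValiantsHypothesis.ValiantsHypothesis.Theorems.BarrierLeverPartitionMinorsHitByVPProductStatesGeneral
import Summits.ValiantsHypothesis.ValiantsHypothesis.Theorems.BarrierLeverPartitionMinorsHitByVPThresholdDoor
import Summits.ValiantsHypothesis.ValiantsHypothesis.Theses.BarrierLever

/-!
# Route BarrierLever — item `PartitionMinorsHitByVP` (stmt-ValiantsHypothesis-19717):
# the bi-threshold door ASSEMBLED to the route declaration

Helper file (`--supports stmt-ValiantsHypothesis-19717`; cell valiant-natproofs, rung V4, 𝒟-side,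
prover seat valiant-natproofs-prover gen 6). Definition-free. Closes NO item.

* `partitionMinor_hit_of_productState` — a single product state (arbitrary complex site tables)
  whose layout minor is nonsingular certifies the layout inside `SmallCircuits ℂ (h+h) 3`.
* **`partitionMinorsHitByVP_of_thresholdSplits`** — hypothesis = the THRESHOLD-SPLIT CONJECTURE
  written out: eventually in `h`, every injective layout is either certified by one product state or
  has a bi-threshold split (`λ, μ : Fin h → ℤ`, cuts, bijections of the threshold cells and of
  their complements) whose two cells are certified by product states; conclusion = item
  `PartitionMinorsHitByVP` VERBATIM, with `b = 3`. Evidence for the hypothesis: kit censuses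
  j253355/j253364/j253366/j253367 (h = 3 exhaustive, h ≤ 7 sampled: no exception; memo
  `HOME/prover/gen6/ADAPTIVE-WITNESSES-MEMO-g6.md` §7).

WHAT THIS IS NOT: the hypothesis is OPEN (a combinatorial statement about threshold cells of subsets
of the cube); nothing on crux 14610 / VP vs VNP.
-/

set_option linter.dupNamespace false

namespace Summit.ValiantsHypothesis.ValiantsHypothesis.Theorems.BarrierLever.ThresholdDoor

open Finset
open Literature.Barriers.ValiantsHypothesis
open Summit.ValiantsHypothesis.ValiantsHypothesis.Theorems.BarrierLever.ProductStatesC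
  (coeff_prodStateC twoProdStatesC_mem_smallCircuits)

/-- **One product state.** If a product state with site tables `P` has a nonsingular layout minor,
the layout is hit inside `SmallCircuits ℂ (h+h) 3` (`h ≥ 4`). -/
theorem partitionMinor_hit_of_productState (h r : ℕ) (hh : 4 ≤ h) (u w : Fin r → Finset (Fin h))
    (P : Fin h → Bool → Bool → ℂ)
    (hp : (Matrix.of fun i j : Fin r =>
        ∏ a : Fin h, P a (decide (a ∈ u i)) (decide (a ∈ w j))).det ≠ 0) :
    ∃ f ∈ SmallCircuits ℂ (h + h) 3,
      (Matrix.of fun i j : Fin r => MvPolynomial.coeff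
        (∑ a ∈ u i, Finsupp.single (Fin.castAdd h a) 1 +
          ∑ c ∈ w j, Finsupp.single (Fin.natAdd h c) 1) f).det ≠ 0 := by
  refine ⟨_, twoProdStatesC_mem_smallCircuits hh 1 0 P P, ?_⟩
  have hM : (Matrix.of fun i j : Fin r => MvPolynomial.coeff
      (∑ a ∈ u i, Finsupp.single (Fin.castAdd h a) 1 + ∑ c ∈ w j, Finsupp.single (Fin.natAdd h c) 1)
      (MvPolynomial.C (1 : ℂ) * (∏ a, ∑ p : Bool × Bool, MvPolynomial.C (P a p.1 p.2) *
          MvPolynomial.X (Fin.castAdd h a) ^ p.1.toNat *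
          MvPolynomial.X (Fin.natAdd h ((Equiv.refl (Fin h)) a)) ^ p.2.toNat) +
        MvPolynomial.C (0 : ℂ) * (∏ a, ∑ p : Bool × Bool, MvPolynomial.C (P a p.1 p.2) *
          MvPolynomial.X (Fin.castAdd h a) ^ p.1.toNat *
          MvPolynomial.X (Fin.natAdd h ((Equiv.refl (Fin h)) a)) ^ p.2.toNat) :
          MvPolynomial (Fin (h + h)) ℂ)) =
      Matrix.of fun i j : Fin r => ∏ a : Fin h, P a (decide (a ∈ u i)) (decide (a ∈ w j)) := by
    ext i j
    rw [Matrix.of_apply, Matrix.of_apply, MvPolynomial.coeff_add, MvPolynomial.coeff_C_mul,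
      MvPolynomial.coeff_C_mul, coeff_prodStateC, one_mul, zero_mul, add_zero]
    rfl
  rw [hM]
  exact hp

/-- **The threshold-split conjecture implies item 19717** (`b = 3`). -/
theorem partitionMinorsHitByVP_of_thresholdSplits (h₀ : ℕ)
    (hsplit : ∀ h : ℕ, h₀ ≤ h → ∀ (r : ℕ) (u w : Fin r → Finset (Fin h)),
      Function.Injective u → Function.Injective w →
      (∃ P : Fin h → Bool → Bool → ℂ, (Matrix.of fun i j : Fin r =>
          ∏ a : Fin h, P a (decide (a ∈ u i)) (decide (a ∈ w j))).det ≠ 0) ∨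
      (∃ (lam mu : Fin h → ℤ) (cu cw : ℤ)
        (e : {i : Fin r // cu < ∑ a ∈ u i, lam a} ≃ {j : Fin r // cw < ∑ c ∈ w j, mu c})
        (e' : {i : Fin r // ¬ cu < ∑ a ∈ u i, lam a} ≃ {j : Fin r // ¬ cw < ∑ c ∈ w j, mu c})
        (P Q : Fin h → Bool → Bool → ℂ),
        (Matrix.of fun i i' : {i : Fin r // cu < ∑ a ∈ u i, lam a} =>
            ∏ a : Fin h, P a (decide (a ∈ u i.1)) (decide (a ∈ w (e i').1))).det ≠ 0 ∧
        (Matrix.of fun i i' : {i : Fin r // ¬ cu < ∑ a ∈ u i, lam a} =>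
            ∏ a : Fin h, Q a (decide (a ∈ u i.1)) (decide (a ∈ w (e' i').1))).det ≠ 0)) :
    Summit.ValiantsHypothesis.ValiantsHypothesis.Theses.BarrierLever.PartitionMinorsHitByVP := by
  refine ⟨3, max h₀ 4, fun h hh r u w hu hw => ?_⟩
  have hh4 : 4 ≤ h := (le_max_right _ _).trans hh
  rcases hsplit h ((le_max_left _ _).trans hh) r u w hu hw with ⟨P, hP⟩ | ⟨lam, mu, cu, cw, e, e', P, Q, hP, hQ⟩
  · exact partitionMinor_hit_of_productState h r hh4 u w P hP
  · exact partitionMinor_hit_of_thresholdSplit h r hh4 u w lam mu cu cw e e' P Q hP hQ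

end Summit.ValiantsHypothesis.ValiantsHypothesis.Theorems.BarrierLever.ThresholdDoor
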